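import Literature.NumberTheory.Automorphic.ResGL2InteriorHalfReduction
import Literature.NumberTheory.Automorphic.BianchiOrdinaryClassicalityProofs
import HarnessLib

/-!
# The interior half of `Harder1987_eigensystem_cuspidalOrEisenstein` in degree zero

Topic `NumberTheory/Automorphic`; namespace `Literature.NumberTheory.Automorphic.ResGLnCohomology`.
Theorems only (no definition, no named fact, no `sorry`); the `Res_{F/ℚ} GL_n` analogue of
`ParallelWeight.interiorCohomology_zero_eq_bot` / `bianchi_interiorEigenclass_isCuspidal_degree_zero`
(`BianchiOrdinaryClassicalityProofs`).

* `interiorLevelCohomology_zero_eq_bot` — **`H⁰_!(S_{K_f(𝔫)}, Ẽ_λ) = 0`** for `Res_{K/ℚ} GL_n`,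
  `n ≥ 2` (the Tits building of `GL_n/K` is non-empty and a degree-`0` class restricting to zero on
  it vanishes: the generic `TwistedQuotient.interiorCohomology_zero_eq_bot`)
  [cite: Schwermer2010, §5.3];
* `eigenformComparison_degree_zero` — hence the comparison hypothesis `hC` of
  `Harder1987_eigensystem_cuspidalOrEisenstein_of_eigenformComparison`
  (`ResGL2InteriorHalfReduction`) holds in degree `q = 0` (vacuously: there is no non-zero interior
  class); the content of `hC` is in degrees `1 ≤ q` [cite: Harder1987, §3.2 (3.2.5)].

## References

* J. Schwermer, Bull. AMS 47 (2010), §5.3. [Schwermer2010]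
* G. Harder, Invent. Math. 89 (1987), §3.2. [Harder1987]
-/

noncomputable section

open scoped Classical
open NumberField IsDedekindDomain

namespace Literature.NumberTheory.Automorphic

namespace ResGLnCohomology

open Literature.NumberTheory.GaloisRepresentations

section DegreeZero

variable (k : Type) [Field k] (n : ℕ) (K : Type) [Field K] [NumberField K]

/-- **`H⁰_!(S_{K_f(𝔫)}, Ẽ_λ(k)) = 0` for `Res_{K/ℚ} GL_n`, `n ≥ 2`** (every field `k`, weight `λ`,
level `𝔫`). [cite: Schwermer2010, §5.3] -/
theorem interiorLevelCohomology_zero_eq_bot (hn : 2 ≤ n) (𝔫 : Ideal (𝓞 K))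
    (lam : (K →+* k) → Fin n → ℤ) : interiorLevelCohomology k n K 𝔫 lam 0 = ⊥ := by
  haveI := ParallelWeight.properSubspace_nonempty K n hn
  exact TwistedQuotient.interiorCohomology_zero_eq_bot _ _ _ _ _

end DegreeZero

/-- **The comparison `hC` of `ResGL2InteriorHalfReduction` in degree `q = 0`** (vacuous: a non-zero
interior class of degree `0` does not exist, `interiorLevelCohomology_zero_eq_bot`); binders as in
`hC` with `q := 0`. [cite: Harder1987, §3.2 (3.2.5)] [cite: Schwermer2010, §5.3] -/
theorem eigenformComparison_degree_zero (F : Type) [Field F] [NumberField F]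
    (hcpt : isCompact_glFiniteIntegralLevel 2 F) (E : Type) [Field E] (ι : E ≃+* ℂ)
    (𝔫 : Ideal (𝓞 F)) (lam : (F →+* E) → Fin 2 → ℤ) (c : levelCohomology E 2 F 𝔫 lam 0)
    (hc : c ∈ interiorLevelCohomology E 2 F 𝔫 lam 0) (hc0 : c ≠ 0)
    (a : HeightOneSpectrum (𝓞 F) → ℕ → E) :
    (∃ (π₀ : CuspidalAutomorphicRepData 2 F hcpt) (𝔪 : Ideal (𝓞 F))
        (φ : (AdelicGroupData.gl 2 F).Adelic → ℂ),
      π₀.1.IsRegularAlgebraic ∧ 𝔪 ≠ 0 ∧ φ ∈ π₀.1.W ∧ φ ∉ π₀.1.W' ∧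
      (∀ u ∈ principalCongruenceLevel 2 F 𝔪, rightTranslation (AdelicGroupData.gl 2 F) u φ = φ) ∧
      ∀ᶠ w in Filter.cofinite, ∀ j, 1 ≤ j → j ≤ 2 →
        heckeOperator (rightTranslation (AdelicGroupData.gl 2 F)) (principalCongruenceLevel 2 F 𝔪)
          (heckeDiagAt 2 F w (BigHeckeGLn.uniformizerAt w) j) φ - ι (a w j) • φ ∈ π₀.1.W') ∨
    (∃ (𝔣 : Ideal (𝓞 F)) (p₁ q₁ p₂ q₂ : InfinitePlace F → ℤ)
        (ψ₁ ψ₂ : HeightOneSpectrum (𝓞 F) → ℂ),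
      𝔣 ≠ ⊥ ∧ IsGrossencharakter 𝔣 p₁ q₁ ψ₁ ∧ IsGrossencharakter 𝔣 p₂ q₂ ψ₂ ∧
      ∀ᶠ w in Filter.cofinite, ι (a w 1) = ψ₁ w + ψ₂ w ∧
        ((Ideal.absNorm w.asIdeal : ℕ) : ℂ) * ι (a w 2) = ψ₁ w * ψ₂ w) := by
  refine absurd ?_ hc0
  rw [interiorLevelCohomology_zero_eq_bot E 2 F le_rfl 𝔫 lam] at hc
  exact (Submodule.mem_bot E).1 hc

end ResGLnCohomology

end Literature.NumberTheory.Automorphic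

end
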